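import Mathlib.NumberTheory.NumberField.Completion.InfinitePlace
import Mathlib.Analysis.Complex.Polynomial.Basic
import Literature.NumberTheory.GaloisRepresentations.AbsGaloisGroup
import Literature.NumberTheory.GaloisRepresentations.TateH2VanishingCyclic
import HarnessLib

/-!
# Tate's theorem at the archimedean places: `H²(G_{K_v}, ℚ/ℤ) = 0` for `K_v = ℝ, ℂ`
# (Serre, Durham 1977, §6.5 (b): "The case when `K` is Archimedean is trivial")

Sibling proof file of `TateProjectiveLifting.lean` (theorems only).  For an infinite place `w` of
a number field `K`, the completion `K_w` is `ℝ` or `ℂ` (Mathlib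
`NumberField.InfinitePlace.Completion.ringEquivRealOfIsReal` / `ringEquivComplexOfIsComplex`),
`ℂ` is an algebraic closure of `K_w` of degree `≤ 2`, so `Γ_{K_w} ≅ Aut_{K_w}(ℂ)` is finite of
order `≤ 2` (`finite_absoluteGaloisGroup_completion_infinitePlace`,
`natCard_absoluteGaloisGroup_completion_infinitePlace_le_two`), hence cyclic and (being
Hausdorff) discrete; by `twoCocycle_addCircle_split_of_isCyclic` (`TateH2VanishingCyclic.lean`)
every `2`-cocycle `Γ_{K_w} × Γ_{K_w} → ℚ/ℤ` is a coboundary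
(`twoCocycle_addCircle_split_absoluteGaloisGroup_completion_infinitePlace`).

## References

* J.-P. Serre, *Modular forms of weight one and Galois representations* (Durham 1975), 1977,
  §6.5 (b). [`SerreDurham1977`]
* J.-P. Serre, *Galois Cohomology* (1997), I §2.4 (the case `G = Gal(ℂ/ℝ)`).
  [`SerreGaloisCohomology1997`]
-/

noncomputable section

open Function Field NumberField

namespace Literature.NumberTheory.GaloisRepresentations

section Archimedean

variable {K : Type*} [Field K]

/-- For an infinite place `w`, `ℂ` is an algebraic closure of `K_w` of degree `≤ 2`, whence an
isomorphism `Γ_{K_w} ≃ Aut_{K_w}(ℂ)` with a group of order `≤ 2`: packaged as the existence of an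
injection of `Γ_{K_w}` into a finite type with at most `2` elements. [folklore] -/
theorem exists_injective_absoluteGaloisGroup_completion_infinitePlace (w : InfinitePlace K) :
    ∃ (T : Type) (_ : Fintype T) (f : absoluteGaloisGroup w.Completion → T),
      Injective f ∧ Fintype.card T ≤ 2 := by
  rcases w.isReal_or_isComplex with hw | hw
  · let e : w.Completion ≃+* ℝ := InfinitePlace.Completion.ringEquivRealOfIsReal hw
    letI : Algebra w.Completion ℂ := (Complex.ofRealHom.comp e.toRingHom).toAlgebra
    have hrank : Module.finrank w.Completion ℂ = 2 := by
      rw [Algebra.finrank_eq_of_equiv_equiv e (RingEquiv.refl ℂ) (by ext; rfl),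
        Complex.finrank_real_complex]
    haveI : FiniteDimensional w.Completion ℂ :=
      Module.finite_of_finrank_pos (by rw [hrank]; exact two_pos)
    haveI : IsAlgClosure w.Completion ℂ := ⟨Complex.isAlgClosed, Algebra.IsAlgebraic.of_finite _ _⟩
    let φ : AlgebraicClosure w.Completion ≃ₐ[w.Completion] ℂ :=
      IsAlgClosure.equiv w.Completion _ ℂ
    refine ⟨(ℂ ≃ₐ[w.Completion] ℂ), inferInstance, fun σ => AlgEquiv.autCongr φ σ,
      (AlgEquiv.autCongr φ).injective, ?_⟩
    exact AlgEquiv.card_le.trans hrank.le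
  · let e : w.Completion ≃+* ℂ := InfinitePlace.Completion.ringEquivComplexOfIsComplex hw
    letI : Algebra w.Completion ℂ := e.toRingHom.toAlgebra
    have hrank : Module.finrank w.Completion ℂ = 1 := by
      rw [Algebra.finrank_eq_of_equiv_equiv e (RingEquiv.refl ℂ) (by ext; rfl), Module.finrank_self]
    haveI : FiniteDimensional w.Completion ℂ :=
      Module.finite_of_finrank_pos (by rw [hrank]; exact one_pos)
    haveI : IsAlgClosure w.Completion ℂ := ⟨Complex.isAlgClosed, Algebra.IsAlgebraic.of_finite _ _⟩
    let φ : AlgebraicClosure w.Completion ≃ₐ[w.Completion] ℂ :=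
      IsAlgClosure.equiv w.Completion _ ℂ
    refine ⟨(ℂ ≃ₐ[w.Completion] ℂ), inferInstance, fun σ => AlgEquiv.autCongr φ σ,
      (AlgEquiv.autCongr φ).injective, ?_⟩
    exact AlgEquiv.card_le.trans (by rw [hrank]; exact one_le_two)

/-- **The absolute Galois group of an archimedean completion is finite** (of order `≤ 2`).
[cite: SerreGaloisCohomology1997, I §2.4] -/
theorem finite_absoluteGaloisGroup_completion_infinitePlace (w : InfinitePlace K) :
    Finite (absoluteGaloisGroup w.Completion) := by
  obtain ⟨T, _, f, hf, -⟩ := exists_injective_absoluteGaloisGroup_completion_infinitePlace w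
  exact Finite.of_injective f hf

/-- The absolute Galois group of an archimedean completion has order `≤ 2`.
[cite: SerreGaloisCohomology1997, I §2.4] -/
theorem natCard_absoluteGaloisGroup_completion_infinitePlace_le_two (w : InfinitePlace K) :
    Nat.card (absoluteGaloisGroup w.Completion) ≤ 2 := by
  obtain ⟨T, _, f, hf, hT⟩ := exists_injective_absoluteGaloisGroup_completion_infinitePlace w
  exact (Nat.card_le_card_of_injective f hf).trans (by rwa [Nat.card_eq_fintype_card])

/-- The absolute Galois group of an archimedean completion is cyclic (of order `1` or `2`).
[cite: SerreGaloisCohomology1997, I §2.4] -/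
theorem isCyclic_absoluteGaloisGroup_completion_infinitePlace (w : InfinitePlace K) :
    IsCyclic (absoluteGaloisGroup w.Completion) := by
  haveI := finite_absoluteGaloisGroup_completion_infinitePlace w
  have hle := natCard_absoluteGaloisGroup_completion_infinitePlace_le_two w
  have hpos : 0 < Nat.card (absoluteGaloisGroup w.Completion) := Nat.card_pos
  interval_cases h : Nat.card (absoluteGaloisGroup w.Completion)
  · haveI : Subsingleton (absoluteGaloisGroup w.Completion) :=
      (Nat.card_eq_one_iff_unique.1 h).1
    infer_instance
  · haveI : Fact (Nat.Prime 2) := ⟨Nat.prime_two⟩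
    exact isCyclic_of_prime_card h

/-- **Tate's theorem at an archimedean place, cochain form: every locally constant `2`-cocycle
`Γ_{K_w} × Γ_{K_w} → ℚ/ℤ` is the coboundary of a locally constant cochain** (`Γ_{K_w}` is finite
cyclic and discrete; `H²(C, ℚ/ℤ) = 0` for finite cyclic `C`).  Serre: "The case when `K` is
Archimedean is trivial." [cite: SerreDurham1977, §6.5 (b)] -/
theorem twoCocycle_addCircle_split_absoluteGaloisGroup_completion_infinitePlace
    (w : InfinitePlace K)
    (f : absoluteGaloisGroup w.Completion → absoluteGaloisGroup w.Completion → AddCircle (1 : ℚ))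
    (hf : IsLocallyConstant (Function.uncurry f))
    (hcoc : ∀ σ τ υ, f σ τ + f (σ * τ) υ = f τ υ + f σ (τ * υ)) :
    ∃ b : absoluteGaloisGroup w.Completion → AddCircle (1 : ℚ), IsLocallyConstant b ∧
      ∀ σ τ, f σ τ + b (σ * τ) = b σ + b τ := by
  haveI := finite_absoluteGaloisGroup_completion_infinitePlace w
  haveI := isCyclic_absoluteGaloisGroup_completion_infinitePlace w
  exact twoCocycle_addCircle_split_of_isCyclic_of_discreteTopology f hf hcoc

/-- The `p`-torsion (`(H_p)`) form of
`twoCocycle_addCircle_split_absoluteGaloisGroup_completion_infinitePlace`.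
[cite: SerreDurham1977, §6.5 (b)] -/
theorem twoCocycle_addCircle_prime_split_absoluteGaloisGroup_completion_infinitePlace
    (w : InfinitePlace K) {p : ℕ}
    (f : absoluteGaloisGroup w.Completion → absoluteGaloisGroup w.Completion → AddCircle (1 : ℚ))
    (hf : IsLocallyConstant (Function.uncurry f))
    (hcoc : ∀ σ τ υ, f σ τ + f (σ * τ) υ = f τ υ + f σ (τ * υ)) (_hpf : ∀ σ τ, p • f σ τ = 0) :
    ∃ b : absoluteGaloisGroup w.Completion → AddCircle (1 : ℚ), IsLocallyConstant b ∧
      ∀ σ τ, f σ τ + b (σ * τ) = b σ + b τ :=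
  twoCocycle_addCircle_split_absoluteGaloisGroup_completion_infinitePlace w f hf hcoc

end Archimedean

end Literature.NumberTheory.GaloisRepresentations

end
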